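import Mathlib
import Literature.RingTheory.Valuation.RootReduction
import Summits.ValiantsHypothesis.ValiantsHypothesis.Theorems.FeketeSOSDepthZeroShadow

/-!
# Crux `FeketeSOS.SublinearShadow` (stmt-ValiantsHypothesis-14990), line `Sketch` (reshape 4),
# stub `stub_gaussPairModel`: Gauss's lemma pair model on a valuation subring of `ℂ`

Let `O ⊂ ℂ` be a valuation subring (valuation `v`, Gauss value `gaussVal O f = max_n v(f_n)` from
`Literature/RingTheory/Valuation/RootReduction.lean`).  If a product `A · B ∈ ℂ[X]` has all its
coefficients in `O`, then `A · B = A' · B'` with `A', B'` coefficientwise in `O` and no new monomials: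
for `A ≠ 0` take `A' = A / a`, `B' = a · B` for a coefficient `a` of `A` of maximal valuation.

Proof.  **Gauss normalisation** (`gpm_normalise`, as in `dzs_term_model`): `A / a` has Gauss value `1`,
so it lifts to `H_A ∈ O[X]` whose coefficient in the dominant degree is `1`, whence `H̄_A ≠ 0` over the
residue field.  **Gauss's lemma** (`gpm_gaussVal_mul`): writing `A = a · H_A`, `B = b · H_B`, the
reduction `H̄_A · H̄_B` of `H_A · H_B` is non-zero (the residue field is a domain), so
`gaussVal (H_A H_B) = 1` (`gaussVal_map_eq_one`) and `gaussVal (A B) = v(a) v(b) = gaussVal A · gaussVal B`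
(`gaussVal_C_mul`).  Finally `gaussVal B' = v(a) · gaussVal B = gaussVal (A B) ≤ 1`, i.e. `B'` is
`O`-integral, while `gaussVal A' = 1`.
-/

namespace Summit.ValiantsHypothesis.ValiantsHypothesis.Theorems.SublinearShadowSketch

open Polynomial Finset IsLocalRing
open Literature.RingTheory.Valuation

-- `Summit.ValiantsHypothesis.ValiantsHypothesis.…` is the tree's mandated single-conjunct layout (Sub = Summit).
set_option linter.dupNamespace false

/-- **Gauss normalisation.**  A non-zero `A ∈ ℂ[X]` has a coefficient `a ≠ 0` of maximal valuation
(`v a = gaussVal A`), and `A / a` is the image of some `H ∈ O[X]` with non-zero reduction (the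
coefficient of `H` in the dominant degree is `1`). -/
theorem gpm_normalise (O : ValuationSubring ℂ) {A : ℂ[X]} (hA : A ≠ 0) :
    ∃ (a : ℂ) (H : O[X]), a ≠ 0 ∧ O.valuation a = gaussVal O A ∧
      H.map (algebraMap O ℂ) = C a⁻¹ * A ∧ H.map (residue O) ≠ 0 := by
  obtain ⟨i, hi⟩ := exists_valuation_coeff_eq_gaussVal O hA
  set a : ℂ := A.coeff i with ha
  have hva : O.valuation a ≠ 0 := by
    rw [hi]; exact gaussVal_ne_zero O hA
  have ha0 : a ≠ 0 := (Valuation.ne_zero_iff _).mp hva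
  -- the normalised polynomial `h = a⁻¹ A` has Gauss value `1`, hence coefficients in `O`
  set h : ℂ[X] := C a⁻¹ * A with hh
  have hgauss : gaussVal O h = 1 := by
    rw [hh, gaussVal_C_mul, map_inv₀, ← hi, inv_mul_cancel₀ hva]
  have hcoef : ∀ n, h.coeff n ∈ O := fun n => by
    rw [← O.valuation_le_one_iff]
    calc O.valuation (h.coeff n) ≤ gaussVal O h := valuation_coeff_le_gaussVal O h n
      _ = 1 := hgauss
  obtain ⟨H, hH, -⟩ := dzs_exists_lift O hcoef
  -- the `i`-th coefficient of `H` is `1`, so the reduction of `H` is non-zero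
  have hHi : H.coeff i = 1 := by
    apply IsFractionRing.injective O ℂ
    rw [← coeff_map, hH, hh, coeff_C_mul, ← ha, inv_mul_cancel₀ ha0, map_one]
  refine ⟨a, H, ha0, hi, hH, fun h0 => ?_⟩
  have h1 := congrArg (fun P => P.coeff i) h0
  simp only [coeff_map, hHi, map_one, coeff_zero] at h1
  exact one_ne_zero h1

/-- **Gauss's lemma** on a valuation subring `O ⊂ ℂ`: the Gauss value is multiplicative,
`gaussVal (A · B) = gaussVal A · gaussVal B`. -/
theorem gpm_gaussVal_mul (O : ValuationSubring ℂ) (A B : ℂ[X]) :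
    gaussVal O (A * B) = gaussVal O A * gaussVal O B := by
  by_cases hA : A = 0
  · rw [hA, zero_mul, gaussVal_zero, zero_mul]
  by_cases hB : B = 0
  · rw [hB, mul_zero, gaussVal_zero, mul_zero]
  obtain ⟨a, HA, ha0, hva, hHA, hHAr⟩ := gpm_normalise O hA
  obtain ⟨b, HB, hb0, hvb, hHB, hHBr⟩ := gpm_normalise O hB
  -- `A B = (a b) · (H_A H_B)` with `H_A H_B ∈ O[X]` of non-zero reduction
  have hprod : A * B = C (a * b) * (HA * HB).map (algebraMap O ℂ) := by
    rw [Polynomial.map_mul, hHA, hHB]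
    calc A * B = C (a * a⁻¹ * (b * b⁻¹)) * (A * B) := by
          rw [mul_inv_cancel₀ ha0, mul_inv_cancel₀ hb0, mul_one, C_1, one_mul]
      _ = C (a * b) * (C a⁻¹ * A * (C b⁻¹ * B)) := by
          simp only [C_mul]; ring
  have hred : (HA * HB).map (residue O) ≠ 0 := by
    rw [Polynomial.map_mul]
    exact mul_ne_zero hHAr hHBr
  rw [hprod, gaussVal_C_mul, gaussVal_map_eq_one O hred, mul_one, map_mul, hva, hvb]

/-- **Stub (i): Gauss pair model.**  On a valuation subring `O ⊂ ℂ`, a product `A·B ∈ ℂ[X]` all of whose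
coefficients lie in `O` can be rewritten as `A'·B'` with `A', B'` coefficientwise in `O` and no new
monomials (`A' = A/a`, `B' = a·B` for a coefficient `a` of `A` of maximal valuation: Gauss's lemma
`v_G(A·B) = v_G(A)·v_G(B)`). [folklore] -/
theorem stub_gaussPairModel (O : ValuationSubring ℂ) (A B : ℂ[X]) (hAB : ∀ n, (A * B).coeff n ∈ O) :
    ∃ A' B' : ℂ[X], A' * B' = A * B ∧ (∀ n, A'.coeff n ∈ O) ∧ (∀ n, B'.coeff n ∈ O) ∧
      A'.support ⊆ A.support ∧ B'.support ⊆ B.support := by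
  by_cases hA : A = 0
  · -- `A = 0`: take `A' = B' = 0`
    refine ⟨0, 0, ?_, fun n => ?_, fun n => ?_, ?_, ?_⟩
    · rw [hA, zero_mul, zero_mul]
    · rw [coeff_zero]; exact zero_mem O
    · rw [coeff_zero]; exact zero_mem O
    · rw [support_zero]; exact Finset.empty_subset _
    · rw [support_zero]; exact Finset.empty_subset _
  -- `A ≠ 0`: rescale by a coefficient `a` of `A` of maximal valuation
  obtain ⟨i, hi⟩ := exists_valuation_coeff_eq_gaussVal O hA
  set a : ℂ := A.coeff i with ha
  have hva : O.valuation a ≠ 0 := by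
    rw [hi]; exact gaussVal_ne_zero O hA
  have ha0 : a ≠ 0 := (Valuation.ne_zero_iff _).mp hva
  have hgAB : gaussVal O (A * B) ≤ 1 :=
    gaussVal_le O fun n => (O.valuation_le_one_iff _).mpr (hAB n)
  refine ⟨C a⁻¹ * A, C a * B, ?_, fun n => ?_, fun n => ?_, dzs_support_C_mul_subset _ _,
    dzs_support_C_mul_subset _ _⟩
  · calc C a⁻¹ * A * (C a * B) = C (a⁻¹ * a) * (A * B) := by rw [C_mul]; ring
      _ = A * B := by rw [inv_mul_cancel₀ ha0, C_1, one_mul]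
  · rw [← O.valuation_le_one_iff]
    calc O.valuation ((C a⁻¹ * A).coeff n) ≤ gaussVal O (C a⁻¹ * A) :=
          valuation_coeff_le_gaussVal O _ n
      _ = 1 := by rw [gaussVal_C_mul, map_inv₀, hi, inv_mul_cancel₀ (gaussVal_ne_zero O hA)]
  · rw [← O.valuation_le_one_iff]
    calc O.valuation ((C a * B).coeff n) ≤ gaussVal O (C a * B) := valuation_coeff_le_gaussVal O _ n
      _ = gaussVal O (A * B) := by rw [gaussVal_C_mul, hi, gpm_gaussVal_mul]
      _ ≤ 1 := hgAB

end Summit.ValiantsHypothesis.ValiantsHypothesis.Theorems.SublinearShadowSketch
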